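import Literature.Probability.Percolation.BergKahnLogSupermodular
import HarnessLib

/-!
# The C-free pair law (AC): the four-point inequality (Ψ-notR) is a THEOREM, and the pendant reduction of (K), (AC), (AC′)
(BENCH rows M2-R77 (companion (Ψ-notR)) and M2-R80 (pendant calculus), PROOFS §P64; gen 22 of the constants-miner seat
`prim-rate-mine-2`, lane prim-rate (c))

Support file (`--supports stmt-CriticalPhenomena-4575`).  No definitions, no named facts, no sorries.  Imports only
`Literature.Probability.Percolation.BergKahnLogSupermodular` (van den Berg–Kahn Thm 1.1, Harris via `prodBernoulli_harris`).

SETTING (as in `…QuantitativePairABVdBKCovariance.lean`).  `μ = prodBernoulli w`, vertices `x, a, b, u`, `T = {x↔a}`, `F = {x↔b}`,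
`G = {x↔u}`, `τ_A = μ(⋂_{v∈A} {x↔v})`; `Cov(F,G) = τ_{bu} − τ_bτ_u`; the van den Berg–Kahn slack at `t = a`,
`W_a = (τ_{bu} − τ_{abu})(1 − τ_a) − (τ_b − τ_{ab})(τ_u − τ_{au}) = μ(Q_{bu}R_a)μ(R_a) − μ(Q_bR_a)μ(Q_uR_a) ≥ 0`; the four-point form
`Ψ4 = τ_{abu} + τ_aτ_{bu} − τ_bτ_{au} − τ_uτ_{ab}` (`= E[(1_{F′}−1_F)(1_{G′}−1_G); x↔a]` for two independent copies).

* `CSH.pab_notR_mul_eq` — the IDENTITY `(1 − τ_a)·(2Cov(F,G) − Ψ4) = W_a + (τ_{ab} − τ_aτ_b)(τ_{au} − τ_aτ_u) + (1 − τ_a)²·Cov(F,G)`;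
* **`CSH.pab_notR_nonneg`** — THEOREM (Ψ-notR): `Ψ4 ≤ 2·Cov(F,G)`, i.e. `E[(1_{F′}−1_F)(1_{G′}−1_G); x↮a] ≥ 0`, for every finite
  weighted graph (van den Berg–Kahn Thm 1.1 at `t = a` + Harris ×3; the case `τ_a = 1` separately);
* `CSH.pab_pendant_K_eq`, `CSH.pab_pendant_AC_eq`, `CSH.pab_pendant_ACprime_eq` — the PENDANT REDUCTION (bookkeeping identities): if the
  seven connection probabilities of a vertex `a′` are `r` times those of `a` (`τ_{a′} = rτ_a`, `τ_{a′b} = rτ_{ab}`, `τ_{a′u} = rτ_{au}`,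
  `τ_{a′bu} = rτ_{abu}` — the case of a leaf `a′` hanging off `a` by one edge of weight `r`), then with `D := τ_aτ_{abu} − τ_{ab}τ_{au}`:
  `K(a′) = r·Ψ4(a) − r²·D`, `AC(a′) = r·AC(a) + r(1−r)·D`, `V(a′) = r·(V(a) + D) − r²·D` — whence the universal statements
  (K), (AC), (AC′) are equivalent to their first-order («pendant») forms (Ψ4), `AC + D ≥ 0`, `V + D ≥ 0`, all three of which fail
  on explicit weighted graphs (PROOFS §P64: exact rational witnesses).
[cite: Harris1960, Lemma 4.1 (p. 16)] [cite: VandenbergKahn2001, Thm 1.1 (p. 123)]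
-/

noncomputable section

namespace Summit.CriticalPhenomena.PercolationContinuityZ3.Theorems.CSH

open MeasureTheory Set unitInterval
open Literature.Probability.LatticeModels (prodBernoulli prodBernoulli_harris)
open Literature.Probability.Percolation
open scoped Classical

variable {V : Type} [Fintype V] [DecidableEq V]

section NotR

variable (w : Sym2 V → unitInterval) (x a b u : V)

omit [Fintype V] [DecidableEq V] in
/-- **Identity behind (Ψ-notR)** (PROOFS §P64 (c)): with `Cov(F,G) = τ_{bu} − τ_bτ_u`, `W_a` the van den Berg–Kahn slack at `t = a`
and `Ψ4 = τ_{abu} + τ_aτ_{bu} − τ_bτ_{au} − τ_uτ_{ab}`: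
`(1 − τ_a)·(2·Cov(F,G) − Ψ4) = W_a + (τ_{ab} − τ_aτ_b)·(τ_{au} − τ_aτ_u) + (1 − τ_a)²·Cov(F,G)`.  A polynomial identity (`ring`). [folklore] -/
theorem pab_notR_mul_eq :
    (1 - (prodBernoulli w).real (openConn x a)) *
        (2 * ((prodBernoulli w).real (openConn x b ∩ openConn x u) - (prodBernoulli w).real (openConn x b) * (prodBernoulli w).real (openConn x u))
          - ((prodBernoulli w).real (openConn x a ∩ openConn x b ∩ openConn x u)
              + (prodBernoulli w).real (openConn x a) * (prodBernoulli w).real (openConn x b ∩ openConn x u)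
              - (prodBernoulli w).real (openConn x b) * (prodBernoulli w).real (openConn x a ∩ openConn x u)
              - (prodBernoulli w).real (openConn x u) * (prodBernoulli w).real (openConn x a ∩ openConn x b)))
      = (((prodBernoulli w).real (openConn x b ∩ openConn x u) - (prodBernoulli w).real (openConn x a ∩ openConn x b ∩ openConn x u)) *
            (1 - (prodBernoulli w).real (openConn x a))
          - ((prodBernoulli w).real (openConn x b) - (prodBernoulli w).real (openConn x a ∩ openConn x b)) *
            ((prodBernoulli w).real (openConn x u) - (prodBernoulli w).real (openConn x a ∩ openConn x u)))
        + ((prodBernoulli w).real (openConn x a ∩ openConn x b) - (prodBernoulli w).real (openConn x a) * (prodBernoulli w).real (openConn x b)) *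
            ((prodBernoulli w).real (openConn x a ∩ openConn x u) - (prodBernoulli w).real (openConn x a) * (prodBernoulli w).real (openConn x u))
        + (1 - (prodBernoulli w).real (openConn x a)) ^ 2 *
            ((prodBernoulli w).real (openConn x b ∩ openConn x u) - (prodBernoulli w).real (openConn x b) * (prodBernoulli w).real (openConn x u)) := by
  ring

omit [DecidableEq V] in
/-- **THEOREM (Ψ-notR)** (PROOFS §P64 (c); the companion inequality of BENCH row M2-R77, conjectured there with 0 failures):
for Bernoulli bond percolation on every finite weighted graph and all vertices `x, a, b, u`,
`τ_{abu} + τ_a·τ_{bu} − τ_b·τ_{au} − τ_u·τ_{ab} ≤ 2·(τ_{bu} − τ_b·τ_u)`, i.e. `Ψ4 ≤ 2·Cov(1_{x↔b}, 1_{x↔u})` — in two-copy language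
`E[(1_{F′} − 1_F)(1_{G′} − 1_G); x↮a] ≥ 0`.  Proof: by `pab_notR_mul_eq`, `(1 − τ_a)` times the slack is the sum of the vdBK slack
`W_a ≥ 0` (Thm 1.1 of van den Berg–Kahn at `t = a`), the product of two Harris slacks, and `(1 − τ_a)²·Cov(F,G) ≥ 0` (Harris);
if `τ_a < 1` divide, and if `τ_a = 1` Harris forces `τ_{ab} = τ_b`, `τ_{au} = τ_u`, `τ_{abu} = τ_{bu}` and the slack is `0`.
[cite: VandenbergKahn2001, Thm 1.1 (p. 123)] [cite: Harris1960, Lemma 4.1 (p. 16)] -/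
theorem pab_notR_nonneg :
    (prodBernoulli w).real (openConn x a ∩ openConn x b ∩ openConn x u)
        + (prodBernoulli w).real (openConn x a) * (prodBernoulli w).real (openConn x b ∩ openConn x u)
        - (prodBernoulli w).real (openConn x b) * (prodBernoulli w).real (openConn x a ∩ openConn x u)
        - (prodBernoulli w).real (openConn x u) * (prodBernoulli w).real (openConn x a ∩ openConn x b)
      ≤ 2 * ((prodBernoulli w).real (openConn x b ∩ openConn x u) - (prodBernoulli w).real (openConn x b) * (prodBernoulli w).real (openConn x u)) := by
  have hid := pab_notR_mul_eq w x a b u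
  -- van den Berg–Kahn Thm 1.1 at `t = a` in `τ`-coordinates: `W_a ≥ 0`
  have hWa : ((prodBernoulli w).real (openConn x b) - (prodBernoulli w).real (openConn x a ∩ openConn x b)) *
        ((prodBernoulli w).real (openConn x u) - (prodBernoulli w).real (openConn x a ∩ openConn x u)) ≤
      ((prodBernoulli w).real (openConn x b ∩ openConn x u) - (prodBernoulli w).real (openConn x a ∩ openConn x b ∩ openConn x u)) *
        (1 - (prodBernoulli w).real (openConn x a)) := by
    have h := BergKahn.bergKahn_thm_1_1 w x b u a
    set μ := prodBernoulli w with hμ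
    have hic : ∀ (A B : Set (BondConfig V)), μ.real (A ∩ Bᶜ) = μ.real A - μ.real (A ∩ B) := by
      intro A B
      have h1 := measureReal_inter_add_sdiff (μ := μ) (s := A) (t := B) MeasurableSet.of_discrete
      rw [Set.sdiff_eq_compl_inter, Set.inter_comm Bᶜ A] at h1
      linarith
    have hc : ∀ (B : Set (BondConfig V)), μ.real Bᶜ = 1 - μ.real B :=
      fun B => probReal_compl_eq_one_sub MeasurableSet.of_discrete
    rw [hic, hic, hic, hc] at h
    have e1 : (openConn x b ∩ openConn x a : Set (BondConfig V)) = openConn x a ∩ openConn x b := Set.inter_comm _ _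
    have e2 : (openConn x u ∩ openConn x a : Set (BondConfig V)) = openConn x a ∩ openConn x u := Set.inter_comm _ _
    have e3 : (openConn x b ∩ openConn x u ∩ openConn x a : Set (BondConfig V)) = openConn x a ∩ openConn x b ∩ openConn x u := by
      ext ω; simp only [Set.mem_inter_iff]; tauto
    rw [e1, e2, e3] at h
    exact h
  set μ := prodBernoulli w with hμ
  set ta := μ.real (openConn x a)
  set tb := μ.real (openConn x b)
  set tu := μ.real (openConn x u)
  set tab := μ.real (openConn x a ∩ openConn x b)
  set tau := μ.real (openConn x a ∩ openConn x u)
  set tbu := μ.real (openConn x b ∩ openConn x u)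
  set tabu := μ.real (openConn x a ∩ openConn x b ∩ openConn x u)
  have hTG : ta * tu ≤ tau := prodBernoulli_harris w (isUpperSet_openConn x a) (isUpperSet_openConn x u)
    MeasurableSet.of_discrete MeasurableSet.of_discrete
  have hFG : tb * tu ≤ tbu := prodBernoulli_harris w (isUpperSet_openConn x b) (isUpperSet_openConn x u)
    MeasurableSet.of_discrete MeasurableSet.of_discrete
  have hTF : ta * tb ≤ tab := prodBernoulli_harris w (isUpperSet_openConn x a) (isUpperSet_openConn x b)
    MeasurableSet.of_discrete MeasurableSet.of_discrete
  have hTFG : ta * tbu ≤ tabu := by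
    have h := prodBernoulli_harris w (isUpperSet_openConn x a) ((isUpperSet_openConn x b).inter (isUpperSet_openConn x u))
      MeasurableSet.of_discrete MeasurableSet.of_discrete
    have e : (openConn x a ∩ (openConn x b ∩ openConn x u) : Set (BondConfig V)) = openConn x a ∩ openConn x b ∩ openConn x u :=
      (Set.inter_assoc _ _ _).symm
    rw [e] at h
    exact h
  have hta1 : ta ≤ 1 := measureReal_le_one
  have htab_le : tab ≤ tb := measureReal_mono Set.inter_subset_right
  have htau_le : tau ≤ tu := measureReal_mono Set.inter_subset_right
  have htabu_le : tabu ≤ tbu := measureReal_mono (show (openConn x a ∩ openConn x b ∩ openConn x u : Set (BondConfig V))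
      ⊆ openConn x b ∩ openConn x u by rw [Set.inter_assoc]; exact Set.inter_subset_right)
  -- `(1 − τ_a)` times the slack is non-negative
  have hprod : 0 ≤ (1 - ta) * (2 * (tbu - tb * tu) - (tabu + ta * tbu - tb * tau - tu * tab)) := by
    rw [hid]
    have h2 : 0 ≤ (tab - ta * tb) * (tau - ta * tu) := mul_nonneg (by linarith) (by linarith)
    have h3 : 0 ≤ (1 - ta) ^ 2 * (tbu - tb * tu) := mul_nonneg (sq_nonneg _) (by linarith)
    linarith
  by_cases hz : ta = 1
  · -- degenerate case τ_a = 1: Harris forces τ_{ab} = τ_b, τ_{au} = τ_u, τ_{abu} = τ_{bu}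
    have e1 : tab = tb := le_antisymm htab_le (by rw [hz] at hTF; linarith)
    have e2 : tau = tu := le_antisymm htau_le (by rw [hz] at hTG; linarith)
    have e3 : tabu = tbu := le_antisymm htabu_le (by rw [hz] at hTFG; linarith)
    rw [hz, e1, e2, e3]; ring_nf; linarith
  · have hlt : 0 < 1 - ta := by
      rcases lt_or_eq_of_le hta1 with h | h
      · linarith
      · exact absurd h hz
    have := (mul_nonneg_iff_of_pos_left hlt).1 hprod
    linarith

end NotR

section Pendant

/-! ### The pendant reduction (bookkeeping identities)

If a vertex `a′` has connection probabilities `τ_{a′} = r·τ_a`, `τ_{a′b} = r·τ_{ab}`, `τ_{a′u} = r·τ_{au}`, `τ_{a′bu} = r·τ_{abu}`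
(a leaf hanging off `a` by a single edge of weight `r`: `x↔a′` iff `x↔a` and that edge is open, the edge being independent of the
cluster of `x` in the rest of the graph), then the three functionals of the C-free pair law transform as recorded below
(`D := τ_aτ_{abu} − τ_{ab}τ_{au} = τ_a²·Cov(1_{x↔b}, 1_{x↔u} ∣ x↔a)`).  Letting `r → 0⁺` shows that the universal statements
(K) `W_a ≤ Cov(F,G)`, (AC) and (AC′) imply — and, by the proved regime `D ≥ 0`, are equivalent to — (Ψ4), `AC + D ≥ 0`,
`V + D ≥ 0` respectively; PROOFS §P64 gives exact rational counterexamples to all three. -/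

variable (r ta tb tu tab tau tbu tabu : ℝ)

/-- **Pendant reduction of (K)** (PROOFS §P64 (a)): `K(a′) = r·Ψ4(a) − r²·D(a)` where `K = Cov(F,G) − W_a`. [folklore] -/
theorem pab_pendant_K_eq :
    ((tbu - tb * tu) - ((tbu - r * tabu) * (1 - r * ta) - (tb - r * tab) * (tu - r * tau)))
      = r * (tabu + ta * tbu - tb * tau - tu * tab) - r ^ 2 * (ta * tabu - tab * tau) := by
  ring

/-- **Pendant reduction of (AC)** (PROOFS §P64 (a)): with
`AC = τ_{au} − τ_aτ_u + τ_{au}(τ_{ab} − 2τ_b) + τ_{bu}(2τ_a − τ_{ab}) + τ_{abu}(τ_b − τ_a)` (BENCH l.226 (B)),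
`AC(a′) = r·AC(a) + r(1 − r)·D(a)`. [folklore] -/
theorem pab_pendant_AC_eq :
    (r * tau - r * ta * tu + r * tau * (r * tab - 2 * tb) + tbu * (2 * (r * ta) - r * tab) + r * tabu * (tb - r * ta))
      = r * (tau - ta * tu + tau * (tab - 2 * tb) + tbu * (2 * ta - tab) + tabu * (tb - ta)) + r * (1 - r) * (ta * tabu - tab * tau) := by
  ring

/-- **Pendant reduction of (AC′)** (PROOFS §P64 (a)): with `V = τ_a·Cov(F,G) + (τ_b − τ_a)(τ_{abu} − τ_bτ_{au}) + (τ_{au} − τ_{bu})(τ_{ab} − τ_aτ_b)`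
(BENCH l.240 (B), the «weighted-Harris» cubic), `V(a′) = r·(V(a) + D(a)) − r²·D(a)`. [folklore] -/
theorem pab_pendant_ACprime_eq :
    (r * ta * (tbu - tb * tu) + (tb - r * ta) * (r * tabu - tb * (r * tau)) + (r * tau - tbu) * (r * tab - r * ta * tb))
      = r * ((ta * (tbu - tb * tu) + (tb - ta) * (tabu - tb * tau) + (tau - tbu) * (tab - ta * tb)) + (ta * tabu - tab * tau))
        - r ^ 2 * (ta * tabu - tab * tau) := by
  ring

end Pendant

end Summit.CriticalPhenomena.PercolationContinuityZ3.Theorems.CSH
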